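import Literature.AlgebraicGeometry.KTheory.PullbackVectorBundle
import Mathlib.LinearAlgebra.FreeModule.StrongRankCondition
import HarnessLib

/-!
# Vector bundles are exactly the finite locally free modules; pull-back of vector bundles

The tree has two renderings of "finite locally free `𝒪_X`-module" on a scheme `X`:
`Literature.AlgebraicGeometry.Motives.IsVectorBundle E` (= Mathlib `SheafOfModules.IsLocallyFree E ∧
SheafOfModules.IsFiniteType E`, `Motives/ChernClasses.lean`) and
`Literature.AlgebraicGeometry.Motives.IsFiniteLocallyFree E` (every point has a neighbourhood `U`
with `E|_U ≅ 𝒪_U^I`, `I` finite; `Motives/ChernClassesProofs.lean`, The Stacks project, Tag 01C6,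
Def. 17.14.1 (2)), and proves only `IsFiniteLocallyFree.isVectorBundle`. This file proves the
converse — so the two notions are EQUIVALENT (`isVectorBundle_iff_isFiniteLocallyFree`) — and
derives that vector bundles pull back to vector bundles along any morphism of schemes
(`IsVectorBundle.pullback`, from `IsFiniteLocallyFree.pullback` of `KTheory/PullbackVectorBundle`,
Stacks 01C8); in particular the "easy direction" of Görtz–Wedhorn II Prop. 24.95 ("If `ℱ` is
locally free of rank `r`, then `ℱ_{/Z} = (i_n^* ℱ)_n` is clearly locally free").

* `finite_of_epi_free`: on a ringed site whose ring `End(𝒪)` is commutative with `𝟙 ≠ 0`, an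
  epimorphism `𝒪^K ↠ 𝒪^I` with `K` finite forces `I` finite (dualise into `Hom(-, 𝒪)` and use the
  strong rank condition of non-zero commutative rings);
* `end_unit_mul_comm`, `end_unit_id_ne_zero`: on the opens over a non-empty open `W` of a scheme,
  `End(𝒪)` is commutative and `𝟙 ≠ 0`;
* `isFiniteLocallyFree_of_isVectorBundle` (Stacks 01C6: (1) + finite type ⇒ (2)): at `x`, restrict a
  trivialisation `E|_U ≅ 𝒪^I` and finitely many generators of `E|_V` to `W = U ∩ V ∋ x`;
* `isVectorBundle_iff_isFiniteLocallyFree`, `IsVectorBundle.isFiniteLocallyFree`,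
  `IsVectorBundle.pullback`, `IsVectorBundle.of_iso`.

Provenance: the proofs of the first four theorems are PORTED VERBATIM into `Literature` from the
summit-side work file `Summits/HodgeConjecture/HodgeConjecture/Theorems/FormalLiftingFromClassLifting/
Negative/VectorBundleConverse.lean` (refuter-cdisprove-stmt-HodgeConjecture-13825-g4-0, 2026-08-16),
of which three further verbatim copies exist in summit work files because `Literature` lacked the
statement; known mathematics belongs here (theorems only; no definition is introduced).

## References

* The Stacks project, Tags 01C6 (locally free modules, Def. 17.14.1), 01C8 (pull-back).
  [StacksProject]
* U. Görtz, T. Wedhorn, *Algebraic Geometry II* (2023), proof of Prop. 24.95, first sentence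
  (p. 567). [GortzWedhorn2023]
-/

universe u v' u'

open CategoryTheory Limits AlgebraicGeometry Opposite
open Literature.AlgebraicGeometry.Motives

noncomputable section

namespace Literature.AlgebraicGeometry.Modules


/-! ## Rank: an epimorphism `free K ↠ free I` with `K` finite forces `I` finite -/

section Rank

variable {C : Type u'} [Category.{v'} C] {J : GrothendieckTopology C} {R : Sheaf J RingCat.{u}}
  [HasWeakSheafify J AddCommGrpCat.{u}] [J.WEqualsLocallyBijective AddCommGrpCat.{u}]

/-- Morphisms out of a free sheaf of modules are determined by their restrictions along the
tautological inclusions `ιFree i : 𝒪 ⟶ 𝒪^I` (Mathlib's `isColimitFreeCofan`, retyped on `free I`).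
[folklore] -/
theorem free_hom_ext {I : Type u} {Z : SheafOfModules.{u} R} (f g : SheafOfModules.free I ⟶ Z)
    (h : ∀ i, SheafOfModules.ιFree i ≫ f = SheafOfModules.ιFree i ≫ g) : f = g :=
  Cofan.IsColimit.hom_ext (SheafOfModules.isColimitFreeCofan I) _ _ fun i => h i

/-- **An epimorphism `𝒪^K ↠ 𝒪^I` of free sheaves of modules with `K` finite forces `I` finite**, on any
ringed site on which the endomorphism ring `End(𝒪)` of the unit module is commutative with `𝟙 ≠ 0`.
Proof: `Hom(-, 𝒪)` turns the epimorphism into an injective `End(𝒪)`-linear map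
`End(𝒪)^I → End(𝒪)^K`; restrict it to `#K + 1` coordinates and apply the strong rank condition of
the non-zero commutative ring `End(𝒪)` (Mathlib's `card_le_of_injective`). [folklore] -/
theorem finite_of_epi_free {I K : Type u} [Finite K]
    (hcomm : ∀ a b : End (SheafOfModules.unit R), a * b = b * a)
    (hnt : (𝟙 (SheafOfModules.unit R) : End (SheafOfModules.unit R)) ≠ 0)
    (π : SheafOfModules.free (R := R) K ⟶ SheafOfModules.free (R := R) I) [Epi π] : Finite I := by
  classical
  letI : CommRing (End (SheafOfModules.unit R)) :=
    { (inferInstance : Ring (End (SheafOfModules.unit R))) with mul_comm := hcomm }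
  haveI : Nontrivial (End (SheafOfModules.unit R)) := ⟨⟨_, _, hnt⟩⟩
  by_contra hI
  rw [not_finite_iff_infinite] at hI
  haveI := Fintype.ofFinite K
  -- `#K + 1` distinct coordinates of `I`
  let emb : Fin (Fintype.card K + 1) ↪ I := Fin.valEmbedding.trans (Infinite.natEmbedding I)
  -- extension by zero of a coefficient vector to all of `I`
  let δ : (Fin (Fintype.card K + 1) → End (SheafOfModules.unit R)) →
      I → End (SheafOfModules.unit R) :=
    fun c => Function.extend emb c (0 : I → End (SheafOfModules.unit R))
  have hδ_emb : ∀ c j, δ c (emb j) = c j := fun c j => emb.injective.extend_apply c 0 j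
  have hδ_out : ∀ c i, (¬ ∃ j, emb j = i) → δ c i = 0 := fun c i hi =>
    Function.extend_apply' c (0 : I → End (SheafOfModules.unit R)) i hi
  have hδ_add : ∀ c c' i, δ (c + c') i = δ c i + δ c' i := by
    intro c c' i
    by_cases hi : ∃ j, emb j = i
    · obtain ⟨j, rfl⟩ := hi
      rw [hδ_emb, hδ_emb, hδ_emb, Pi.add_apply]
    · rw [hδ_out c i hi, hδ_out c' i hi, hδ_out (c + c') i hi, add_zero]
  have hδ_smul : ∀ (b : End (SheafOfModules.unit R)) c i, δ (b • c) i = b * δ c i := by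
    intro b c i
    by_cases hi : ∃ j, emb j = i
    · obtain ⟨j, rfl⟩ := hi
      rw [hδ_emb, hδ_emb, Pi.smul_apply, smul_eq_mul]
    · rw [hδ_out c i hi, hδ_out (b • c) i hi, mul_zero]
  -- the morphism `free I ⟶ 𝒪` with coordinates `δ c`
  let D : (Fin (Fintype.card K + 1) → End (SheafOfModules.unit R)) →
      (SheafOfModules.free (R := R) I ⟶ SheafOfModules.unit R) :=
    fun c => Cofan.IsColimit.desc (SheafOfModules.isColimitFreeCofan I)
      (fun i => End.asHom (δ c i))
  have hD : ∀ c i, SheafOfModules.ιFree i ≫ D c = End.asHom (δ c i) :=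
    fun c i => Cofan.IsColimit.fac (SheafOfModules.isColimitFreeCofan I) _ i
  have hD_add : ∀ c c', D (c + c') = D c + D c' := by
    intro c c'
    refine free_hom_ext _ _ fun i => ?_
    rw [Preadditive.comp_add, hD, hD, hD, hδ_add]
    rfl
  have hD_smul : ∀ (b : End (SheafOfModules.unit R)) c, D (b • c) = D c ≫ End.asHom b := by
    intro b c
    refine free_hom_ext _ _ fun i => ?_
    rw [hD, ← Category.assoc, hD, hδ_smul]
    rfl
  -- the `End(𝒪)`-linear map `End(𝒪)^(#K+1) → End(𝒪)^K`, `c ↦ (k ↦ ι_k ≫ π ≫ D c)`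
  let Φ : (Fin (Fintype.card K + 1) → End (SheafOfModules.unit R)) →ₗ[End (SheafOfModules.unit R)]
      (K → End (SheafOfModules.unit R)) :=
    { toFun := fun c k => End.of (SheafOfModules.ιFree k ≫ π ≫ D c)
      map_add' := fun c c' => by
        funext k
        change End.of (SheafOfModules.ιFree k ≫ π ≫ D (c + c')) =
          End.of (SheafOfModules.ιFree k ≫ π ≫ D c) + End.of (SheafOfModules.ιFree k ≫ π ≫ D c')
        rw [hD_add, Preadditive.comp_add, Preadditive.comp_add]
        rfl
      map_smul' := fun b c => by
        funext k
        change End.of (SheafOfModules.ιFree k ≫ π ≫ D (b • c)) =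
          b * End.of (SheafOfModules.ιFree k ≫ π ≫ D c)
        rw [hD_smul, End.mul_def]
        change SheafOfModules.ιFree k ≫ π ≫ D c ≫ End.asHom b =
          (SheafOfModules.ιFree k ≫ π ≫ D c) ≫ End.asHom b
        simp only [Category.assoc] }
  have hΦ : Function.Injective Φ := by
    intro c c' hcc'
    rw [← sub_eq_zero] at hcc' ⊢
    rw [← map_sub] at hcc'
    have h0 : ∀ k, SheafOfModules.ιFree k ≫ π ≫ D (c - c') = 0 := fun k => congrFun hcc' k
    have h1 : π ≫ D (c - c') = 0 := by
      refine free_hom_ext _ _ fun k => ?_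
      rw [comp_zero]
      exact h0 k
    have h2 : D (c - c') = 0 := by
      rw [← cancel_epi π, h1, comp_zero]
    funext j
    have h3 := hD (c - c') (emb j)
    rw [h2, comp_zero, hδ_emb] at h3
    exact h3.symm
  have hcard := card_le_of_injective (End (SheafOfModules.unit R)) Φ hΦ
  simp only [Fintype.card_fin] at hcard
  omega

end Rank

/-! ## `End(𝒪)` on the opens over a non-empty open of a scheme -/

section EndUnit

variable {X : Scheme.{u}} (W : X.Opens)

/-- **`End(𝒪)` is commutative** on the site of opens over `W`: open by open an endomorphism of the
unit module is multiplication by its value on `1`, and the sections of `𝒪_X` are commutative rings.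
[folklore] -/
theorem end_unit_mul_comm (a b : End (SheafOfModules.unit (X.ringCatSheaf.over W))) :
    a * b = b * a := by
  change b ≫ a = a ≫ b
  refine SheafOfModules.hom_ext (PresheafOfModules.hom_ext fun Y => ModuleCat.hom_ext
    (LinearMap.ext fun y => ?_))
  let f : (X.ringCatSheaf.over W).obj.obj Y →ₗ[(X.ringCatSheaf.over W).obj.obj Y]
      (X.ringCatSheaf.over W).obj.obj Y := (a.val.app Y).hom
  let g : (X.ringCatSheaf.over W).obj.obj Y →ₗ[(X.ringCatSheaf.over W).obj.obj Y]
      (X.ringCatSheaf.over W).obj.obj Y := (b.val.app Y).hom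
  obtain ⟨z, rfl⟩ : ∃ z : (X.ringCatSheaf.over W).obj.obj Y, z = y := ⟨y, rfl⟩
  change f (g z) = g (f z)
  have hf : ∀ t, f t = t * f 1 := fun t => by
    have h := f.map_smul t 1
    rwa [smul_eq_mul, mul_one, smul_eq_mul] at h
  have hg : ∀ t, g t = t * g 1 := fun t => by
    have h := g.map_smul t 1
    rwa [smul_eq_mul, mul_one, smul_eq_mul] at h
  rw [hg z, hf (z * _), hf z, hg (z * _)]
  have key : ∀ r s t : Γ(X, Y.unop.left), r * s * t = r * t * s := fun r s t => mul_right_comm r s t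
  exact key _ _ _

/-- **`𝟙 ≠ 0` in `End(𝒪)`** on the site of opens over a non-empty open `W` of a scheme. [folklore] -/
theorem end_unit_id_ne_zero [Nonempty W] :
    (𝟙 (SheafOfModules.unit (X.ringCatSheaf.over W)) :
      End (SheafOfModules.unit (X.ringCatSheaf.over W))) ≠ 0 := by
  intro h0
  have key := congrArg (fun u : SheafOfModules.unit (X.ringCatSheaf.over W) ⟶
      SheafOfModules.unit (X.ringCatSheaf.over W) =>
        ((u.val.app (op (Over.mk (𝟙 W)))).hom
          (1 : (X.ringCatSheaf.over W).obj.obj (op (Over.mk (𝟙 W)))) :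
          (X.ringCatSheaf.over W).obj.obj (op (Over.mk (𝟙 W))))) h0
  change (1 : Γ(X, W)) = 0 at key
  exact one_ne_zero key

end EndUnit

/-! ## The converse: vector bundles are finite locally free -/

section Converse

variable {X : Scheme.{u}}

/-- **A vector bundle (Mathlib: locally free and of finite type) on a scheme is finite locally free**
(The Stacks project, Tag 01C6: Def. 17.14.1 (1) + finite type ⇒ Def. 17.14.1 (2) on a locally ringed
space). Proof: at `x`, let `E|_U ≅ 𝒪^I` be a trivialisation and `E|_V` be generated by finitely many
sections (`K` of them); over `W = U ∩ V ∋ x` both restrict (restriction to the opens over `W` is a left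
adjoint, so it preserves epimorphisms), giving an epimorphism `𝒪^K ↠ 𝒪^I` over `W ≠ ∅`, whence `I` is
finite (`finite_of_epi_free`). This is the converse of the tree's `IsFiniteLocallyFree.isVectorBundle`.
[cite: StacksProject, Tag 01C6] -/
theorem isFiniteLocallyFree_of_isVectorBundle {E : X.Modules} (h : IsVectorBundle E) :
    IsFiniteLocallyFree E := by
  classical
  obtain ⟨q, hq⟩ := h.1.exists_isLocallyFreeData
  haveI := h.2
  obtain ⟨q', hq'⟩ := SheafOfModules.IsFiniteType.exists_localGeneratorsData E
  intro x
  obtain ⟨a, ha⟩ := ((Opens.coversTop_iff _ q.X).mp q.coversTop).exists_mem x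
  obtain ⟨b, hb⟩ := ((Opens.coversTop_iff _ q'.X).mp q'.coversTop).exists_mem x
  refine ⟨q.X a, ha, (q.generators a).I, ?_, ⟨asIso (q.generators a).π⟩⟩
  -- it remains to see that the index set `I` of the trivialisation at `x` is finite
  let W : X.Opens := q.X a ⊓ q'.X b
  haveI : Nonempty W := ⟨⟨x, ⟨ha, hb⟩⟩⟩
  haveI : (q'.generators b).IsFiniteType := hq'.isFiniteType b
  -- the trivialisation restricted to `W`
  let eW : SheafOfModules.free (q.generators a).I ≅ E.over W :=
    SheafOfModules.restrictTrivialisation (R := X.ringCatSheaf) (homOfLE inf_le_left)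
      (asIso (q.generators a).π)
  -- the finitely many generators restricted to `W`
  let g : W ⟶ q'.X b := homOfLE inf_le_right
  let πW : SheafOfModules.free (q'.generators b).I ⟶ E.over W :=
    (SheafOfModules.mapFreeIso (SheafOfModules.overMap X.ringCatSheaf g) _
        (SheafOfModules.overMapUnitIso g).symm).hom ≫
      (SheafOfModules.overMap X.ringCatSheaf g).map (q'.generators b).π ≫
        ((SheafOfModules.overFunctorMap X.ringCatSheaf g).app E).hom
  haveI : Epi πW := by
    dsimp only [πW]
    infer_instance
  exact finite_of_epi_free (end_unit_mul_comm W) (end_unit_id_ne_zero W) (πW ≫ eW.inv)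

/-- **Vector bundle = finite locally free** on a scheme: Mathlib's "locally free and of finite type"
(`IsVectorBundle`) is equivalent to Stacks 01C6 (2) (`IsFiniteLocallyFree`).
[cite: StacksProject, Tag 01C6] -/
theorem isVectorBundle_iff_isFiniteLocallyFree {E : X.Modules} :
    IsVectorBundle E ↔ IsFiniteLocallyFree E :=
  ⟨isFiniteLocallyFree_of_isVectorBundle, IsFiniteLocallyFree.isVectorBundle⟩

/-- Dot-notation form of `isFiniteLocallyFree_of_isVectorBundle` (deliberate extension of
`Literature.AlgebraicGeometry.Motives.IsVectorBundle` from the `Modules` directory).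
[cite: StacksProject, Tag 01C6] -/
theorem _root_.Literature.AlgebraicGeometry.Motives.IsVectorBundle.isFiniteLocallyFree
    {E : X.Modules} (h : IsVectorBundle E) : IsFiniteLocallyFree E :=
  isFiniteLocallyFree_of_isVectorBundle h

/-- **Pull-back of a vector bundle is a vector bundle**: for a morphism of schemes `f : Y ⟶ X` and
a vector bundle `E` on `X`, `f^* E = (Scheme.Modules.pullback f).obj E` is a vector bundle (The
Stacks project, Tag 01C8, through `IsFiniteLocallyFree.pullback` of `KTheory/PullbackVectorBundle`
and the equivalence above). In particular the restrictions `i_n^* F` of a vector bundle `F` to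
closed subschemes (e.g. the thickenings of a `W(k)`-scheme) are vector bundles — the easy direction
of Görtz–Wedhorn II, Prop. 24.95. Deliberate dot-notation extension of `IsVectorBundle`.
[cite: StacksProject, Tag 01C8] -/
theorem _root_.Literature.AlgebraicGeometry.Motives.IsVectorBundle.pullback {Y : Scheme.{u}}
    {E : X.Modules} (h : IsVectorBundle E) (f : Y ⟶ X) :
    IsVectorBundle ((Scheme.Modules.pullback f).obj E) :=
  ((isFiniteLocallyFree_of_isVectorBundle h).pullback f).isVectorBundle

/-- Finite local freeness is invariant under isomorphism of modules. [folklore] -/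
theorem isFiniteLocallyFree_of_iso {E E' : X.Modules} (e : E ≅ E') (h : IsFiniteLocallyFree E) :
    IsFiniteLocallyFree E' := fun x => by
  obtain ⟨U, hxU, I, hI, ⟨i⟩⟩ := h x
  exact ⟨U, hxU, I, hI, ⟨i ≪≫ (Scheme.Modules.overFunctor U).mapIso e⟩⟩

/-- Being a vector bundle is invariant under isomorphism of modules (deliberate dot-notation
extension of `IsVectorBundle`). [folklore] -/
theorem _root_.Literature.AlgebraicGeometry.Motives.IsVectorBundle.of_iso {E E' : X.Modules}
    (e : E ≅ E') (h : IsVectorBundle E) : IsVectorBundle E' :=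
  (isFiniteLocallyFree_of_iso e h.isFiniteLocallyFree).isVectorBundle

end Converse

end Literature.AlgebraicGeometry.Modules

end
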